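import Literature.AnabelianGeometry.EtaleTheta.Discharge.Sec3Remark364
import Literature.AnabelianGeometry.EtaleTheta.TemperedFrobenioidProps
import HarnessLib

/-!
# [EtTh] Remark 3.6.4 — the named statement `Remark364` DISCHARGED (tree vocabulary)

S. Mochizuki, *The étale theta function and its Frobenioid-theoretic manifestations*, Publ. RIMS **45**
(2009), Remark 3.6.4 p. 79 (PDF p. 305 of `paper:doi-10-2977-prims-1234361159`): "it follows from
Lemma 3.5 [applied to the submonoid `Φ ⊆ Φ^{ℝ-log}`] that the respective divisor monoids `Φ^pf`, `Φ^rlf`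
of `C^pf`, `C^rlf` also satisfy the conditions of Definition 3.6, (ii)."  abc-iut-L2-t3's named `Prop`
`TemperedFrobenioid.Remark364` (`TemperedFrobenioidProps.lean`) records the perfection clause as three
conjuncts about the perf-saturation `Φ^pf(A) := perfSaturation Φ(A) ⊆ Φ^{ℝ-log}(A)`:
(1) group-saturated, (2) perf-factorial, (3) monoprime base-field part `Φ^pf(A) ∩ ℝ·Φ₀^cnst`.

This proof-only file (abc-iut cell, layer L2, seat abc-iut-L2-d2; no new definitions) proves it over the
tree's monoid vocabulary `treeMonoidVocab`: (1) is abc-iut-L6-t12's `Lemma35.isGroupSaturated_perfSaturation`;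
(2) is `remark364_isPerfFactorial` (`Discharge/Sec3Remark364.lean`); (3) is
`remark364_isMonoprime_bsFld_of_rootClosed` (ibid.), whose root-closure hypothesis on `ℝ·Φ₀^cnst` is now
the structure field `RealifiedDivisorMonoids.cnstR_root` (abc-iut-L2-t3, `TemperedFrobenioid.lean` v2 —
the printed "`ℝ`-vector subspace of `(Φ₀^ℝ)^gp`", Def. 3.6 (i) p. 76).  The realification clause of the
Remark is the universal property `RlfUniversal.existsUnique_lift` / `RealificationFunctor.rlfFunctor`.
-/

namespace Literature.AnabelianGeometry.EtaleTheta

open CategoryTheory Opposite Literature.AlgebraicGeometry.Frobenioids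

universe u₀ v₀ u v w

namespace TemperedFrobenioid

variable {D₀ : Type u₀} [Category.{v₀} D₀] {T : RealifiedDivisorMonoids (D₀ := D₀) treeMonoidVocab.{w}}
  {D : Type u} [Category.{v} D] {VD : FrdICatStub.{u, v, w} D} (C₀ : TemperedFrobenioid T D VD)

/-- **[EtTh] Remark 3.6.4, clause (3), unconditional**: the base-field part of `Φ^pf`,
`perfSaturation Φ(A) ∩ ℝ·Φ₀^cnst`, is monoprime (root-closure of `ℝ·Φ₀^cnst` is the field
`RealifiedDivisorMonoids.cnstR_root`). [cite: MochizukiEtTh2009, Rmk 3.6.4 p.79] -/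
theorem remark364_isMonoprime_bsFld (A : Dᵒᵖ) :
    IsMonoprime ↥(perfSaturation (C₀.Φ.carrier A) ⊓
      (T.cnstR (C₀.baseOp A)).toSubmonoid.comap Algebra.GrothendieckGroup.of) :=
  C₀.remark364_isMonoprime_bsFld_of_rootClosed T.cnstR_root A

/-- **[EtTh] Remark 3.6.4 (perfection clause) holds**: abc-iut-L2-t3's named statement `Remark364`, for
every tempered Frobenioid over the tree's monoid vocabulary — `Φ^pf(A)` is group-saturated in
`Φ^{ℝ-log}(A)`, perf-factorial, and has monoprime base-field part. [cite: MochizukiEtTh2009, Rmk 3.6.4 p.79] -/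
theorem Remark364_holds : C₀.Remark364 := fun A =>
  ⟨Lemma35.isGroupSaturated_perfSaturation _ (C₀.isGroupSaturated A), C₀.remark364_isPerfFactorial A,
    C₀.remark364_isMonoprime_bsFld A⟩

end TemperedFrobenioid

end Literature.AnabelianGeometry.EtaleTheta
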